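import Summits.CriticalPhenomena.PercolationContinuityZ3.Theorems.PercNearOneGluingNoHeavyLowerTailStarSetFamilyBal
import Summits.CriticalPhenomena.PercolationContinuityZ3.Theorems.PercNearOneGluingNoHeavyLowerTailStarSetFamilyRiders
import Summits.CriticalPhenomena.PercolationContinuityZ3.Theorems.PercNearOneGluingNoHeavyLowerTailStarSetFamilyRiderC
import Summits.CriticalPhenomena.PercolationContinuityZ3.Theorems.PercNearOneGluingNoHeavyLowerTailStarSetFamilyRiderR1
import Summits.CriticalPhenomena.PercolationContinuityZ3.Theorems.PercNearOneGluingNoHeavyLowerTailStarSetSwapAdmissible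
import HarnessLib

/-!
# `NoHeavyLowerTail` (stmt-CriticalPhenomena-4575) — the residual bound, I: non-core units (U1-PROOF.md §§6–7; blueprint §G4)

Support file (prover `prim-gen-swap` gen 15; `--supports stmt-CriticalPhenomena-4575`).  No definitions, no named facts, no sorries.

The residual units `u = (S, X)` of the U1′_r charging scheme come with the data of `StarSet.residual_unit_data`: first open forest class
`Jf u`, ports `ef u` (in `Jf u`) and `ēf u` of the hub, and the trichotomy R1 / R2-C / R2-I.  `ρf u` is a chosen NON-INERT rider (a class
of `S ∖ {X, J}` avoiding `r`, other than `dom X ē`) when there is one.  This file pays the NON-CORE units by their words: balanced pairs by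
`familyBal_bound` (½), R1 units with a rider by `familyRiderR1_bound` (1), and the `𝓤_dom` units with a rider through `e` in `F` /
through `e` not in `F` / through `ē` by `familyRiderF_bound` (6/32), `familyRiderC_bound` (6/8 of `wc`), `familyRiderFar_bound` (6/128).

* `StarSet.residual_noncore_bound`.
-/

namespace Summit.CriticalPhenomena.PercolationContinuityZ3.Theorems

open Finset
open scoped BigOperators Classical

namespace StarSet

variable {ι V : Type*} [Fintype ι] [LinearOrder ι] [DecidableEq V]

/-- **The non-core residual units are paid by the BAL / R1-rider / F-rider / chord-rider / far-rider words.**  See the file header. -/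
theorem residual_noncore_bound (P P' : ι → V) (hPP' : ∀ X, P X ≠ P' X)
    (hinj : Function.Injective fun X => (s(P X, P' X) : Sym2 V)) (r : V) (F : Finset ι)
    (θ : ι → ℝ) (hθ0 : ∀ X, 0 ≤ θ X) (hθ1 : ∀ X, θ X < 1)
    (O : ι → V → ℝ) (hO0 : ∀ X d, 0 ≤ O X d) (Φ : ι → ℝ)
    (hO1 : ∀ X d, (P X = d ∨ P' X = d) → θ X ≤ (1 - θ X) * O X d)
    (hO2 : ∀ X, Φ X ^ 2 ≤ O X (P X) * O X (P' X))
    (hΦ4 : ∀ X, 4 * θ X ≤ Φ X) (hΦsq : ∀ X, θ X ≤ Φ X ^ 2)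
    (dom : ι → V → ι)
    (hdom : ∀ X ∉ F, ∀ d, (P X = d ∨ P' X = d) →
      dom X d ∈ F ∧ (P (dom X d) = d ∨ P' (dom X d) = d) ∧
        (∀ u, (P (dom X d) = u ∨ P' (dom X d) = u) → (P X = u ∨ P' X = u) → u = d) ∧ θ X ≤ θ (dom X d))
    (I₀ : ι) (hleaf : ∀ I ∈ F, P' I = r → I = I₀)
    (U : Finset (Finset ι × ι)) (Jf : Finset ι × ι → ι) (ef ēf : Finset ι × ι → V) (ρf : Finset ι × ι → ι)
    (hdata : (∀ u ∈ U, u.2 ∈ u.1 ∧ u.2 ∉ F ∧ (P u.2 ≠ r ∧ P' u.2 ≠ r) ∧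
      (∀ Y ∈ u.1, P Y = P u.2 ∨ P Y = P' u.2 ∨ P' Y = P u.2 ∨ P' Y = P' u.2) ∧
      ¬ ((∀ I ∈ F, I ∉ u.1) ∨ ∃ a ∈ F, P a = r ∧ a ∈ u.1 ∧ ∀ b ∈ F, b < a → b ∉ u.1) ∧
      Jf u ∈ u.1 ∧ Jf u ∈ F ∧ (∀ I ∈ u.1, I ∈ F → Jf u ≤ I) ∧ P (Jf u) ≠ r ∧
      ((P u.2 = ef u ∧ P' u.2 = ēf u) ∨ (P u.2 = ēf u ∧ P' u.2 = ef u)) ∧ (P (Jf u) = ef u ∨ P' (Jf u) = ef u) ∧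
      ¬ (P (Jf u) = ēf u ∨ P' (Jf u) = ēf u) ∧
      ((P (Jf u) = ef u ∧ P' (Jf u) = r ∧ P (dom u.2 (ēf u)) ≠ r ∧ P' (dom u.2 (ēf u)) ≠ r) ∨
       (P (Jf u) ≠ r ∧ P' (Jf u) ≠ r ∧
        ((P (dom u.2 (ēf u)) = r ∧ P' (dom u.2 (ēf u)) = ēf u ∧ Jf u < dom u.2 (ēf u)) ∨
         (P (dom u.2 (ēf u)) = ēf u ∧ P' (dom u.2 (ēf u)) = r)))) ∧
      (∀ Y ∈ u.1, Y ≠ u.2 → (P Y ≠ r ∧ P' Y ≠ r) → ∀ p, (P u.2 = p ∨ P' u.2 = p) → (P Y ≠ p ∧ P' Y ≠ p) →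
        (P (dom u.2 p) = r ∨ P' (dom u.2 p) = r))))
    (hρ : (∀ u ∈ U, (((u.1.erase u.2).erase (Jf u)).filter (fun K => (P K ≠ r ∧ P' K ≠ r) ∧ K ≠ dom u.2 (ēf u))).Nonempty
          → ρf u ∈ (((u.1.erase u.2).erase (Jf u)).filter (fun K => (P K ≠ r ∧ P' K ≠ r) ∧ K ≠ dom u.2 (ēf u))))) :
    ∑ u ∈ U.filter (fun u => (¬ (P (Jf u) = ef u ∧ P' (Jf u) = r) ∧ dom u.2 (ef u) ≠ Jf u ∧ (P (dom u.2 (ef u)) ≠ r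
          ∧ P' (dom u.2 (ef u)) ≠ r))), ((∏ k ∈ u.1, θ k) * ∏ k ∈ univ \ u.1, (1 - θ k)) +
      ∑ u ∈ U.filter (fun u => (P (Jf u) = ef u ∧ P' (Jf u) = r) ∧ (((u.1.erase u.2).erase (Jf u)).filter (fun K => (P K ≠ r ∧ P' K ≠ r)
            ∧ K ≠ dom u.2 (ēf u))).Nonempty), ((∏ k ∈ u.1, θ k) * ∏ k ∈ univ \ u.1, (1 - θ k)) +
      ∑ u ∈ U.filter (fun u => ¬ (P (Jf u) = ef u ∧ P' (Jf u) = r) ∧ ¬ (¬ (P (Jf u) = ef u ∧ P' (Jf u) = r) ∧ dom u.2 (ef u) ≠ Jf u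
            ∧ (P (dom u.2 (ef u)) ≠ r ∧ P' (dom u.2 (ef u)) ≠ r)) ∧ (((u.1.erase u.2).erase (Jf u)).filter (fun K => (P K ≠ r ∧ P' K ≠ r)
            ∧ K ≠ dom u.2 (ēf u))).Nonempty ∧ (P (ρf u) = ef u ∨ P' (ρf u) = ef u) ∧ ρf u ∈ F), ((∏ k ∈ u.1, θ k) * ∏ k ∈ univ \ u.1, (1 - θ k)) +
      ∑ u ∈ U.filter (fun u => ¬ (P (Jf u) = ef u ∧ P' (Jf u) = r) ∧ ¬ (¬ (P (Jf u) = ef u ∧ P' (Jf u) = r) ∧ dom u.2 (ef u) ≠ Jf u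
            ∧ (P (dom u.2 (ef u)) ≠ r ∧ P' (dom u.2 (ef u)) ≠ r)) ∧ (((u.1.erase u.2).erase (Jf u)).filter (fun K => (P K ≠ r ∧ P' K ≠ r)
            ∧ K ≠ dom u.2 (ēf u))).Nonempty ∧ (P (ρf u) = ef u ∨ P' (ρf u) = ef u) ∧ ρf u ∉ F), ((∏ k ∈ u.1, θ k) * ∏ k ∈ univ \ u.1, (1 - θ k)) +
      ∑ u ∈ U.filter (fun u => ¬ (P (Jf u) = ef u ∧ P' (Jf u) = r) ∧ ¬ (¬ (P (Jf u) = ef u ∧ P' (Jf u) = r) ∧ dom u.2 (ef u) ≠ Jf u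
            ∧ (P (dom u.2 (ef u)) ≠ r ∧ P' (dom u.2 (ef u)) ≠ r)) ∧ (((u.1.erase u.2).erase (Jf u)).filter (fun K => (P K ≠ r ∧ P' K ≠ r)
            ∧ K ≠ dom u.2 (ēf u))).Nonempty ∧ ¬ (P (ρf u) = ef u ∨ P' (ρf u) = ef u)), ((∏ k ∈ u.1, θ k) * ∏ k ∈ univ \ u.1, (1 - θ k)) ≤
      (1 / 2) * ∑ T ∈ (U.filter (fun u => (¬ (P (Jf u) = ef u ∧ P' (Jf u) = r) ∧ dom u.2 (ef u) ≠ Jf u ∧ (P (dom u.2 (ef u)) ≠ r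
            ∧ P' (dom u.2 (ef u)) ≠ r)))).image (fun u => ({u.2, Jf u, dom u.2 (ef u)} : Finset ι)), (∑ δ ∈ (univ : Finset (ι
            → Bool)).filter (fun δ => (∀ K ∉ T, δ K = false) ∧
            3 ≤ (T.image fun K => if δ K then P K else P' K).card ∧ r ∉ T.image fun K => if δ K then P K else P' K),
          ∏ K ∈ T, O K (if δ K then P K else P' K)) +
      ∑ T ∈ (U.filter (fun u => (P (Jf u) = ef u ∧ P' (Jf u) = r) ∧ (((u.1.erase u.2).erase (Jf u)).filter (fun K => (P K ≠ r ∧ P' K ≠ r)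
            ∧ K ≠ dom u.2 (ēf u))).Nonempty)).image (fun u => ({u.2, I₀, ρf u} : Finset ι)), (∑ δ ∈ (univ : Finset (ι
            → Bool)).filter (fun δ => (∀ K ∉ T, δ K = false) ∧
            3 ≤ (T.image fun K => if δ K then P K else P' K).card ∧ r ∉ T.image fun K => if δ K then P K else P' K),
          ∏ K ∈ T, O K (if δ K then P K else P' K)) +
      (6 / 32) * ∑ T ∈ (U.filter (fun u => ¬ (P (Jf u) = ef u ∧ P' (Jf u) = r) ∧ ¬ (¬ (P (Jf u) = ef u ∧ P' (Jf u) = r) ∧ dom u.2 (ef u) ≠ Jf u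
            ∧ (P (dom u.2 (ef u)) ≠ r ∧ P' (dom u.2 (ef u)) ≠ r)) ∧ (((u.1.erase u.2).erase (Jf u)).filter (fun K => (P K ≠ r ∧ P' K ≠ r)
            ∧ K ≠ dom u.2 (ēf u))).Nonempty ∧ (P (ρf u) = ef u ∨ P' (ρf u) = ef u)
            ∧ ρf u ∈ F)).image (fun u => ({u.2, Jf u, ρf u} : Finset ι)), (∑ δ ∈ (univ : Finset (ι → Bool)).filter (fun δ => (∀ K ∉ T, δ K = false) ∧
            3 ≤ (T.image fun K => if δ K then P K else P' K).card ∧ r ∉ T.image fun K => if δ K then P K else P' K),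
          ∏ K ∈ T, O K (if δ K then P K else P' K)) +
      (6 / 8) * ∑ T ∈ (U.filter (fun u => ¬ (P (Jf u) = ef u ∧ P' (Jf u) = r) ∧ ¬ (¬ (P (Jf u) = ef u ∧ P' (Jf u) = r) ∧ dom u.2 (ef u) ≠ Jf u
            ∧ (P (dom u.2 (ef u)) ≠ r ∧ P' (dom u.2 (ef u)) ≠ r)) ∧ (((u.1.erase u.2).erase (Jf u)).filter (fun K => (P K ≠ r ∧ P' K ≠ r)
            ∧ K ≠ dom u.2 (ēf u))).Nonempty ∧ (P (ρf u) = ef u ∨ P' (ρf u) = ef u)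
            ∧ ρf u ∉ F)).image (fun u => ({u.2, Jf u, ρf u} : Finset ι)), (∑ δ ∈ ((univ : Finset (ι → Bool)).filter (fun δ => (∀ K ∉ T, δ K = false) ∧
            3 ≤ (T.image fun K => if δ K then P K else P' K).card ∧ r ∉ T.image fun K => if δ K then P K else P' K)).filter
            (fun δ => ∀ K ∈ T, K ∉ F → ∀ I ∈ T, I ∈ F → (if δ K then P K else P' K) ≠ P I ∧ (if δ K then P K else P' K) ≠ P' I),
          ∏ K ∈ T, O K (if δ K then P K else P' K)) +
      (6 / 128) * ∑ T ∈ (U.filter (fun u => ¬ (P (Jf u) = ef u ∧ P' (Jf u) = r) ∧ ¬ (¬ (P (Jf u) = ef u ∧ P' (Jf u) = r) ∧ dom u.2 (ef u) ≠ Jf u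
            ∧ (P (dom u.2 (ef u)) ≠ r ∧ P' (dom u.2 (ef u)) ≠ r)) ∧ (((u.1.erase u.2).erase (Jf u)).filter (fun K => (P K ≠ r ∧ P' K ≠ r)
            ∧ K ≠ dom u.2 (ēf u))).Nonempty ∧ ¬ (P (ρf u) = ef u ∨ P' (ρf u) = ef u))).image (fun u => ({u.2, Jf u, ρf u} : Finset ι)), (∑ δ ∈ (univ : Finset (ι → Bool)).filter (fun δ => (∀ K ∉ T, δ K = false) ∧
            3 ≤ (T.image fun K => if δ K then P K else P' K).card ∧ r ∉ T.image fun K => if δ K then P K else P' K),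
          ∏ K ∈ T, O K (if δ K then P K else P' K)) := by
  have hθ1' : ∀ X, θ X ≤ 1 := fun X => (hθ1 X).le
  -- J avoids r off R1
  have hJr : ∀ u ∈ U, ¬ (P (Jf u) = ef u ∧ P' (Jf u) = r) → P (Jf u) ≠ r ∧ P' (Jf u) ≠ r := by
    intro u hu hn
    obtain ⟨-, -, -, -, -, -, -, -, -, -, -, -, htri, -⟩ := hdata u hu
    rcases htri with ⟨h1, h2, -⟩ | ⟨h1, h2, -⟩
    · exact absurd ⟨h1, h2⟩ hn
    · exact ⟨h1, h2⟩
  -- rider data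
  have hrid : ∀ u ∈ U, (((u.1.erase u.2).erase (Jf u)).filter (fun K => (P K ≠ r ∧ P' K ≠ r) ∧ K ≠ dom u.2 (ēf u))).Nonempty →
      ρf u ∈ u.1 ∧ ρf u ≠ u.2 ∧ ρf u ≠ Jf u ∧ (P (ρf u) ≠ r ∧ P' (ρf u) ≠ r) ∧ ρf u ≠ dom u.2 (ēf u) ∧
      (P (ρf u) = P u.2 ∨ P (ρf u) = P' u.2 ∨ P' (ρf u) = P u.2 ∨ P' (ρf u) = P' u.2) := by
    intro u hu hne
    have h := hρ u hu hne
    obtain ⟨h1, h2, h3⟩ := mem_filter.1 h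
    obtain ⟨hρJ, h1'⟩ := mem_erase.1 h1
    obtain ⟨hρX, hρS⟩ := mem_erase.1 h1'
    obtain ⟨-, -, -, hadj, -⟩ := hdata u hu
    exact ⟨hρS, hρX, hρJ, h2, h3, hadj _ hρS⟩
  -- (1) BAL
  have hbal := familyBal_bound P P' hPP' hinj r F θ hθ0 hθ1' O hO0 Φ hO1 hO2 hΦ4 hΦsq dom hdom (U.filter (fun u => (¬ (P (Jf u) = ef u
        ∧ P' (Jf u) = r) ∧ dom u.2 (ef u) ≠ Jf u ∧ (P (dom u.2 (ef u)) ≠ r ∧ P' (dom u.2 (ef u)) ≠ r)))) Jf ef (fun u hu => by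
    obtain ⟨huU, hb⟩ := mem_filter.1 hu
    obtain ⟨hXS, hXF, hXr, -, -, hJS, hJF, -, -, hX, hJe, -, -, -⟩ := hdata u huU
    have heX : P u.2 = ef u ∨ P' u.2 = ef u := by rcases hX with ⟨h, _⟩ | ⟨_, h⟩; exacts [Or.inl h, Or.inr h]
    exact ⟨hXS, hXF, hXr, hJS, hJF, hJr u huU hb.1, heX, hJe, hb.2.1, hb.2.2⟩)
  -- (2) R1 riders
  have hr1 : ∑ u ∈ U.filter (fun u => (P (Jf u) = ef u ∧ P' (Jf u) = r) ∧ (((u.1.erase u.2).erase (Jf u)).filter (fun K => (P K ≠ r ∧ P' K ≠ r)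
        ∧ K ≠ dom u.2 (ēf u))).Nonempty), ((∏ k ∈ u.1, θ k) * ∏ k ∈ univ \ u.1, (1 - θ k)) ≤
      ∑ T ∈ (U.filter (fun u => (P (Jf u) = ef u ∧ P' (Jf u) = r) ∧ (((u.1.erase u.2).erase (Jf u)).filter (fun K => (P K ≠ r ∧ P' K ≠ r)
            ∧ K ≠ dom u.2 (ēf u))).Nonempty)).image (fun u => ({u.2, I₀, ρf u} : Finset ι)), (∑ δ ∈ (univ : Finset (ι
            → Bool)).filter (fun δ => (∀ K ∉ T, δ K = false) ∧
            3 ≤ (T.image fun K => if δ K then P K else P' K).card ∧ r ∉ T.image fun K => if δ K then P K else P' K),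
          ∏ K ∈ T, O K (if δ K then P K else P' K)) := by
    by_cases hemp : (U.filter (fun u => (P (Jf u) = ef u ∧ P' (Jf u) = r) ∧ (((u.1.erase u.2).erase (Jf u)).filter (fun K => (P K ≠ r ∧ P' K ≠ r)
          ∧ K ≠ dom u.2 (ēf u))).Nonempty)) = ∅
    · rw [hemp]; simp
    obtain ⟨u₀, hu₀⟩ := nonempty_iff_ne_empty.2 hemp
    obtain ⟨hu₀U, ⟨hJe₀, hJr₀⟩, -⟩ := mem_filter.1 hu₀
    obtain ⟨-, -, -, -, -, -, hJF₀, -⟩ := hdata u₀ hu₀U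
    have hI₀ : Jf u₀ = I₀ := hleaf _ hJF₀ hJr₀
    have hI₀F : I₀ ∈ F := hI₀ ▸ hJF₀
    have hI₀r : P' I₀ = r := hI₀ ▸ hJr₀
    refine familyRiderR1_bound P P' hPP' r F θ hθ0 hθ1' O hO0 hO1 hI₀F ⟨rfl, hI₀r⟩ (U.filter (fun u => (P (Jf u) = ef u ∧ P' (Jf u) = r)
          ∧ (((u.1.erase u.2).erase (Jf u)).filter (fun K => (P K ≠ r ∧ P' K ≠ r) ∧ K ≠ dom u.2 (ēf u))).Nonempty)) ρf (fun u hu => ?_)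
    obtain ⟨huU, ⟨hJe, hJr'⟩, hne⟩ := mem_filter.1 hu
    obtain ⟨hXS, hXF, hXr, -, -, hJS, hJF, -, -, hX, -, -, htri, hNR⟩ := hdata u huU
    have hJI : Jf u = I₀ := hleaf _ hJF hJr'
    have heq : ef u = P I₀ := by rw [← hJI]; exact hJe.symm
    obtain ⟨hρS, hρX, -, hρr, -, hρadj⟩ := hrid u huU hne
    have heX : P u.2 = ef u ∨ P' u.2 = ef u := by rcases hX with ⟨h, _⟩ | ⟨_, h⟩; exacts [Or.inl h, Or.inr h]
    have hēX : P u.2 = ēf u ∨ P' u.2 = ēf u := by rcases hX with ⟨_, h⟩ | ⟨h, _⟩; exacts [Or.inr h, Or.inl h]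
    have hcold : P (dom u.2 (ēf u)) ≠ r ∧ P' (dom u.2 (ēf u)) ≠ r := by
      rcases htri with ⟨-, -, h1, h2⟩ | ⟨-, h2, -⟩
      · exact ⟨h1, h2⟩
      · exact absurd hJr' h2
    -- a rider through `q₀ = e` would make the far end hot
    have hρq : ¬ (P (ρf u) = P I₀ ∨ P' (ρf u) = P I₀) := by
      rw [← heq]
      intro hρe
      have hρē : P (ρf u) ≠ ēf u ∧ P' (ρf u) ≠ ēf u := by
        constructor <;> intro h <;> apply hρX <;> apply hinj <;> simp only
        · rcases hρe with h' | h'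
          · exact absurd (h'.symm.trans h) (by rcases hX with ⟨h1, h2⟩ | ⟨h1, h2⟩ <;> [exact fun e => hPP' u.2 (h1.trans (e.trans h2.symm)); exact fun e => hPP' u.2 (h2.symm ▸ h1.symm ▸ e).symm])
          · rcases hX with ⟨h1, h2⟩ | ⟨h1, h2⟩
            · rw [h, h', h1, h2]; exact Sym2.eq_swap
            · rw [h, h', h1, h2]
        · rcases hρe with h' | h'
          · rcases hX with ⟨h1, h2⟩ | ⟨h1, h2⟩
            · rw [h, h', h1, h2]
            · rw [h, h', h1, h2]; exact Sym2.eq_swap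
          · exact absurd (h'.symm.trans h) (by rcases hX with ⟨h1, h2⟩ | ⟨h1, h2⟩ <;> [exact fun e => hPP' u.2 (h1.trans (e.trans h2.symm)); exact fun e => hPP' u.2 (h2.symm ▸ h1.symm ▸ e).symm])
      rcases hNR (ρf u) hρS hρX hρr (ēf u) hēX hρē with h | h
      · exact hcold.1 h
      · exact hcold.2 h
    exact ⟨hXS, hXF, hXr, by rw [← heq]; exact heX, by rw [← hJI]; exact hJS, hρS, hρX, hρr, hρq, hρadj⟩
  -- (3) F-riders through `e`
  have hrF := familyRiderF_bound P P' hPP' hinj r F θ hθ0 hθ1' O hO0 Φ hO1 hO2 hΦ4 (U.filter (fun u => ¬ (P (Jf u) = ef u ∧ P' (Jf u) = r)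
        ∧ ¬ (¬ (P (Jf u) = ef u ∧ P' (Jf u) = r) ∧ dom u.2 (ef u) ≠ Jf u ∧ (P (dom u.2 (ef u)) ≠ r ∧ P' (dom u.2 (ef u)) ≠ r))
        ∧ (((u.1.erase u.2).erase (Jf u)).filter (fun K => (P K ≠ r ∧ P' K ≠ r) ∧ K ≠ dom u.2 (ēf u))).Nonempty
        ∧ (P (ρf u) = ef u ∨ P' (ρf u) = ef u) ∧ ρf u ∈ F)) Jf ρf ef (fun u hu => by
    obtain ⟨huU, hn1, -, hne, hρe, hρF⟩ := mem_filter.1 hu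
    obtain ⟨hXS, hXF, hXr, -, -, hJS, hJF, -, -, hX, hJe, -, -, -⟩ := hdata u huU
    have heX : P u.2 = ef u ∨ P' u.2 = ef u := by rcases hX with ⟨h, _⟩ | ⟨_, h⟩; exacts [Or.inl h, Or.inr h]
    obtain ⟨hρS, -, hρJ, hρr, -, -⟩ := hrid u huU hne
    exact ⟨hXS, hXF, hXr, heX, hJS, hJF, hJr u huU hn1, hJe, hρS, hρF, hρr, hρe, hρJ⟩)
  -- (4) chord riders through `e`
  have hrC := familyRiderC_bound P P' hPP' hinj r F θ hθ0 hθ1' O hO0 Φ hO1 hO2 hΦ4 (U.filter (fun u => ¬ (P (Jf u) = ef u ∧ P' (Jf u) = r)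
        ∧ ¬ (¬ (P (Jf u) = ef u ∧ P' (Jf u) = r) ∧ dom u.2 (ef u) ≠ Jf u ∧ (P (dom u.2 (ef u)) ≠ r ∧ P' (dom u.2 (ef u)) ≠ r))
        ∧ (((u.1.erase u.2).erase (Jf u)).filter (fun K => (P K ≠ r ∧ P' K ≠ r) ∧ K ≠ dom u.2 (ēf u))).Nonempty
        ∧ (P (ρf u) = ef u ∨ P' (ρf u) = ef u) ∧ ρf u ∉ F)) Jf ρf ef (fun u hu => by
    obtain ⟨huU, hn1, -, hne, hρe, hρF⟩ := mem_filter.1 hu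
    obtain ⟨hXS, hXF, hXr, -, -, hJS, hJF, -, -, hX, hJe, -, -, -⟩ := hdata u huU
    have heX : P u.2 = ef u ∨ P' u.2 = ef u := by rcases hX with ⟨h, _⟩ | ⟨_, h⟩; exacts [Or.inl h, Or.inr h]
    obtain ⟨hρS, hρX, -, hρr, -, -⟩ := hrid u huU hne
    exact ⟨hXS, hXF, hXr, heX, hJS, hJF, hJr u huU hn1, hJe, hρS, hρF, hρr, hρe, hρX⟩)
  -- (5) riders through `ē`
  have hrFar := familyRiderFar_bound P P' hPP' hinj r F θ hθ0 hθ1' O hO0 Φ hO2 hΦ4 (U.filter (fun u => ¬ (P (Jf u) = ef u ∧ P' (Jf u) = r)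
        ∧ ¬ (¬ (P (Jf u) = ef u ∧ P' (Jf u) = r) ∧ dom u.2 (ef u) ≠ Jf u ∧ (P (dom u.2 (ef u)) ≠ r ∧ P' (dom u.2 (ef u)) ≠ r))
        ∧ (((u.1.erase u.2).erase (Jf u)).filter (fun K => (P K ≠ r ∧ P' K ≠ r) ∧ K ≠ dom u.2 (ēf u))).Nonempty
        ∧ ¬ (P (ρf u) = ef u ∨ P' (ρf u) = ef u))) Jf ρf ef (fun u hu => by
    obtain ⟨huU, hn1, -, hne, hρe⟩ := mem_filter.1 hu
    obtain ⟨hXS, hXF, hXr, -, -, hJS, hJF, -, -, hX, hJe, -, -, -⟩ := hdata u huU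
    have heX : P u.2 = ef u ∨ P' u.2 = ef u := by rcases hX with ⟨h, _⟩ | ⟨_, h⟩; exacts [Or.inl h, Or.inr h]
    obtain ⟨hρS, hρX, hρJ, hρr, -, hρadj⟩ := hrid u huU hne
    exact ⟨hXS, hXF, hXr, heX, hJS, hJF, hJr u huU hn1, hJe, hρS, hρX, hρJ, hρr, hρe, hρadj⟩)
  linarith [hbal, hr1, hrF, hrC, hrFar]

end StarSet

end Summit.CriticalPhenomena.PercolationContinuityZ3.Theorems
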